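import Summits.CriticalPhenomena.PercolationContinuityZ3.Theorems.PercNearOneGluingNoHeavyPcintThirdBondIneq
import HarnessLib

/-!
# PCINT lane, reduction B3m (`chordmean_cw`: B3t with the corner-third unit): the per-site inequality with three units

Cell `prim-pcint` (PAPER-2 track (iii): certified intervals for `p_c(ℤ^d)`), seat `prim-pcint-2` (gen 4); support file
(`--supports stmt-CriticalPhenomena-4575`).  Does NOT build on p205010.  Memo: `run/shared/lean/prim/pcint/REDUCTIONS.md` §B3m.

B3m pays three kinds of units at an off-path site with `r` incidences: `s` (second incidence, bonus units, corner coins), `t` for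
a linked incidence `k ≥ 2` at gap `≥ 4` from its predecessor or at gap `2` with a BAD corner coin, and `t'` for a linked
incidence `k ≥ 2` at gap `2` with a GOOD corner coin.  The bookkeeping (`…MeanBondUnits`) guarantees, with `g` good pairs:
first pair not good: `a + b + c ≤ r`, `b ≤ (r-2) - g`, `c ≤ g`; first pair good: `a + b + c ≤ r - 2`, `1 ≤ g`, `b ≤ r-1-g`,
`c ≤ g - 1`.  PROVED here, for reals with `0 ≤ p ≤ 1`, `1 - p² ≤ s²`, `s ≤ 1`, `0 ≤ t ≤ t' ≤ s`, `(1-p)(1+2p) ≤ t(1+p)`,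
`p² ≤ (t'-t)(1+p)`:  `siteProb r g p ≤ s^a t^b t'^c` in both cases (`siteProb_le_pow3_of_first_bad/good`).  With
`t = (1-p)(1+2p)/(1+p)`, `t' = (1+p-p²)/(1+p)` every configuration with `r ≤ 3` is an equality.
-/

noncomputable section

namespace Summit.CriticalPhenomena.PercolationContinuityZ3.Theorems.Pcint

namespace ChainBond

section Ineq3

variable {p s t t' : ℝ} (hp0 : 0 ≤ p) (hp1 : p ≤ 1) (hps : 1 - p ^ 2 ≤ s ^ 2) (hs1 : s ≤ 1) (ht0 : 0 ≤ t) (htt : t ≤ t')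
  (hts : t' ≤ s) (htp : (1 - p) * (1 + 2 * p) ≤ t * (1 + p)) (hgap : p ^ 2 ≤ (t' - t) * (1 + p))
include hp0 hp1 hps hs1 ht0 htt hts htp hgap

omit hps hs1 hts in
/-- The good-pair increment with the unit `t'`: `p² (1-p)^{i+j+1} ≤ t^i t'^j (t' - t) · (1 - p²)`… in the usable form
`p² (1-p)^{i+j+1} ≤ (1-p²) · (t^i t'^j (t'-t))`. [folklore] -/
theorem sq_mul_pow_le3 (i j : ℕ) : p ^ 2 * (1 - p) ^ (i + j + 1) ≤ (1 - p ^ 2) * (t ^ i * t' ^ j * (t' - t)) := by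
  have hq : 0 ≤ 1 - p := by linarith
  have h1p_t : 1 - p ≤ t := one_sub_le_t hp0 hp1 htp
  have h1p_t' : 1 - p ≤ t' := h1p_t.trans htt
  have hB : (1 - p) ^ (i + j) ≤ t ^ i * t' ^ j := by
    rw [pow_add]
    exact mul_le_mul (pow_le_pow_left₀ hq h1p_t i) (pow_le_pow_left₀ hq h1p_t' j) (pow_nonneg hq _)
      (pow_nonneg ht0 _)
  have hpos : 0 < 1 + p := by linarith
  have hgap' : p ^ 2 * (1 - p) ≤ (1 - p ^ 2) * (t' - t) := by
    have : p ^ 2 * (1 - p) ≤ (t' - t) * (1 + p) * (1 - p) := mul_le_mul_of_nonneg_right hgap hq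
    nlinarith [this]
  calc p ^ 2 * (1 - p) ^ (i + j + 1) = (p ^ 2 * (1 - p)) * (1 - p) ^ (i + j) := by ring
    _ ≤ ((1 - p ^ 2) * (t' - t)) * (t ^ i * t' ^ j) :=
        mul_le_mul hgap' hB (pow_nonneg hq _) (mul_nonneg (by nlinarith) (sub_nonneg.2 htt))
    _ = (1 - p ^ 2) * (t ^ i * t' ^ j * (t' - t)) := by ring

omit hs1 hts in
/-- **Case "first pair not a good corner pair"**: `siteProb (m+2) g ≤ s² t^{m-g} t'^{g}` for `g ≤ m`. [folklore] -/
theorem siteProb_le_core3_bad {m g : ℕ} (hg : g ≤ m) : siteProb (m + 2) g p ≤ s ^ 2 * t ^ (m - g) * t' ^ g := by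
  induction g with
  | zero =>
    rw [siteProb_add_two', Nat.cast_zero, zero_mul, zero_mul, add_zero, Nat.sub_zero, pow_zero, mul_one]
    exact core_P0 hp0 hp1 hps ht0 htp m
  | succ g ih =>
    have ih' := ih (by omega)
    obtain ⟨k, hk⟩ : ∃ k, m - g = k + 1 := ⟨m - g - 1, by omega⟩
    have hk' : m - (g + 1) = k := by omega
    have hm : m = k + g + 1 := by omega
    rw [hk] at ih'
    rw [hk', siteProb_add_two', show (((g + 1 : ℕ) : ℝ)) = g + 1 by push_cast; ring]
    rw [siteProb_add_two'] at ih'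
    have hinc := sq_mul_pow_le3 hp0 hp1 ht0 htt htp hgap k g
    rw [← hm] at hinc
    have hs2 : 1 - p ^ 2 ≤ s ^ 2 := hps
    have h0 : 0 ≤ t ^ k * t' ^ g * (t' - t) := mul_nonneg (mul_nonneg (pow_nonneg ht0 _) (pow_nonneg (ht0.trans htt) _))
      (sub_nonneg.2 htt)
    have hinc' : p ^ 2 * (1 - p) ^ m ≤ s ^ 2 * (t ^ k * t' ^ g * (t' - t)) :=
      hinc.trans (mul_le_mul_of_nonneg_right hs2 h0)
    have e : s ^ 2 * t ^ k * t' ^ (g + 1) = s ^ 2 * t ^ (k + 1) * t' ^ g + s ^ 2 * (t ^ k * t' ^ g * (t' - t)) := by ring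
    rw [e]
    calc (1 - p) ^ (m + 1) * (1 + (m + 1 : ℝ) * p) + (g + 1) * p ^ 2 * (1 - p) ^ m
        = ((1 - p) ^ (m + 1) * (1 + (m + 1 : ℝ) * p) + g * p ^ 2 * (1 - p) ^ m) + p ^ 2 * (1 - p) ^ m := by ring
      _ ≤ s ^ 2 * t ^ (k + 1) * t' ^ g + s ^ 2 * (t ^ k * t' ^ g * (t' - t)) := add_le_add ih' hinc'

omit hps hs1 hts in
/-- **Case "first pair a good corner pair"**: `siteProb (m+2) (G+1) ≤ t^{m-G} t'^{G}` for `G ≤ m`. [folklore] -/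
theorem siteProb_le_core3_good {m G : ℕ} (hG : G ≤ m) : siteProb (m + 2) (G + 1) p ≤ t ^ (m - G) * t' ^ G := by
  induction G with
  | zero =>
    rw [siteProb_add_two', zero_add, Nat.sub_zero, pow_zero, mul_one]
    have e : (1 - p) ^ (m + 1) * (1 + (m + 1 : ℝ) * p) + ((1 : ℕ) : ℝ) * p ^ 2 * (1 - p) ^ m =
        (1 - p) ^ m * (1 + (m : ℝ) * (p * (1 - p))) := by push_cast; ring
    rw [e]
    exact core_Q hp0 hp1 ht0 htp m
  | succ G ih =>
    have ih' := ih (by omega)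
    obtain ⟨k, hk⟩ : ∃ k, m - G = k + 1 := ⟨m - G - 1, by omega⟩
    have hk' : m - (G + 1) = k := by omega
    have hm : m = k + G + 1 := by omega
    rw [hk] at ih'
    rw [hk', siteProb_add_two', show (((G + 1 + 1 : ℕ) : ℝ)) = G + 1 + 1 by push_cast; ring]
    rw [siteProb_add_two', show (((G + 1 : ℕ) : ℝ)) = G + 1 by push_cast; ring] at ih'
    have hinc := sq_mul_pow_le3 hp0 hp1 ht0 htt htp hgap k G
    rw [← hm] at hinc
    have h0 : 0 ≤ t ^ k * t' ^ G * (t' - t) := mul_nonneg (mul_nonneg (pow_nonneg ht0 _) (pow_nonneg (ht0.trans htt) _))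
      (sub_nonneg.2 htt)
    have hinc' : p ^ 2 * (1 - p) ^ m ≤ t ^ k * t' ^ G * (t' - t) := by
      refine hinc.trans ?_
      have : 1 - p ^ 2 ≤ 1 := by nlinarith
      calc (1 - p ^ 2) * (t ^ k * t' ^ G * (t' - t)) ≤ 1 * (t ^ k * t' ^ G * (t' - t)) :=
            mul_le_mul_of_nonneg_right this h0
        _ = _ := one_mul _
    have e : t ^ k * t' ^ (G + 1) = t ^ (k + 1) * t' ^ G + t ^ k * t' ^ G * (t' - t) := by ring
    rw [e]
    calc (1 - p) ^ (m + 1) * (1 + (m + 1 : ℝ) * p) + (G + 1 + 1) * p ^ 2 * (1 - p) ^ m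
        = ((1 - p) ^ (m + 1) * (1 + (m + 1 : ℝ) * p) + (G + 1) * p ^ 2 * (1 - p) ^ m) + p ^ 2 * (1 - p) ^ m := by ring
      _ ≤ t ^ (k + 1) * t' ^ G + t ^ k * t' ^ G * (t' - t) := add_le_add ih' hinc'

omit hp0 hp1 hps htp hgap in
/-- **Three-unit monotonicity**: moving units to `s` or dropping them increases `s^a t^b t'^c`. [folklore] -/
theorem pow3_mono {A B C a b c : ℕ} (hb : b ≤ B) (hc : c ≤ C) (habc : a + b + c ≤ A + B + C) :
    s ^ A * t ^ B * t' ^ C ≤ s ^ a * t ^ b * t' ^ c := by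
  have ht'0 : 0 ≤ t' := ht0.trans htt
  have hs0 : 0 ≤ s := ht'0.trans hts
  obtain ⟨i, rfl⟩ : ∃ i, B = b + i := ⟨B - b, by omega⟩
  obtain ⟨j, rfl⟩ : ∃ j, C = c + j := ⟨C - c, by omega⟩
  calc s ^ A * t ^ (b + i) * t' ^ (c + j) = s ^ A * (t ^ i * t' ^ j) * (t ^ b * t' ^ c) := by rw [pow_add, pow_add]; ring
    _ ≤ s ^ A * (s ^ i * s ^ j) * (t ^ b * t' ^ c) := by
        refine mul_le_mul_of_nonneg_right (mul_le_mul_of_nonneg_left (mul_le_mul (pow_le_pow_left₀ ht0 (htt.trans hts) i)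
          (pow_le_pow_left₀ ht'0 hts j) (pow_nonneg ht'0 _) (pow_nonneg hs0 _)) (pow_nonneg hs0 _)) ?_
        positivity
    _ = s ^ (A + i + j) * (t ^ b * t' ^ c) := by rw [pow_add, pow_add]; ring
    _ ≤ s ^ a * (t ^ b * t' ^ c) := mul_le_mul_of_nonneg_right (pow_le_pow_of_le_one hs0 hs1 (by omega)) (by positivity)
    _ = s ^ a * t ^ b * t' ^ c := by ring

/-- **Per-site inequality (B3m), first pair not a good corner pair**: `a + b + c ≤ r`, `b + g ≤ r - 2`, `c ≤ g`. [folklore] -/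
theorem siteProb_le_pow3_of_first_bad {m g a b c : ℕ} (hbg : b + g ≤ m) (hcg : c ≤ g) (habc : a + b + c ≤ m + 2) :
    siteProb (m + 2) g p ≤ s ^ a * t ^ b * t' ^ c :=
  (siteProb_le_core3_bad hp0 hp1 hps ht0 htt htp hgap (by omega)).trans
    (pow3_mono hs1 ht0 htt hts (b := b) (c := c) (by omega) hcg (by omega))

omit hps in
/-- **Per-site inequality (B3m), first pair a good corner pair**: `a + b + c ≤ r - 2`, `1 ≤ g`, `b + g ≤ r - 1`, `c + 1 ≤ g`.
[folklore] -/
theorem siteProb_le_pow3_of_first_good {m g a b c : ℕ} (hg1 : 1 ≤ g) (hbg : b + g ≤ m + 1) (hcg : c + 1 ≤ g)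
    (habc : a + b + c ≤ m) : siteProb (m + 2) g p ≤ s ^ a * t ^ b * t' ^ c := by
  obtain ⟨G, rfl⟩ : ∃ G, g = G + 1 := ⟨g - 1, by omega⟩
  refine (siteProb_le_core3_good hp0 hp1 ht0 htt htp hgap (by omega : G ≤ m)).trans ?_
  have := pow3_mono hs1 ht0 htt hts (A := 0) (B := m - G) (C := G) (a := a) (b := b) (c := c) (by omega) (by omega) (by omega)
  simpa using this

end Ineq3

end ChainBond

end Summit.CriticalPhenomena.PercolationContinuityZ3.Theorems.Pcint
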